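import Summits.QuantumFields.YangMills.Theorems.UnitScaleTiltHalvingHSiteRawP5OfLeaf
import HarnessLib

/-!
# `hP1room` PROGRAMME (LEAD-H BOARD v5 → v6, LEAD-H g5 `LOCATE-K-SOCK` «the row AFTER (K-final)»; LEAD-H g6 WORD 9 «(K-sock) GO»), ROW (K-sock) FILE A′:
# ★★ THEOREM 4's RAW PROPOSITION-5 BASE SOCKET `hP5base` IN `G`-FORM AT N05's CUBE MEMBER OF RECORD, FLAT BACKGROUND, FROM THE [4] LETTERS (+ their `τ`-laws) AT TRUNCATION `1`
# — lit ✓`B8SockHFPTraceFree.sockHFP₀_body_of_join_RD_traceFree` + FILE A's `G`-form adapter ✓`HalvingHSiteRawP5OfLeaf.hP5_step_mem_of_HFP` at `m = 0`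

Route `UnitScaleTilt`, crux K1 child «MinimiserStabilityRegPr» (stmt-QuantumFields-19200), registered stub `stub_halvingStep` (`BirthV10`).  Cell `ym3-torus` (HUMAN RULING
D-0037: YM₃ on T³ is ladder rung R3 — NOT d = 4, NOT a mass gap, NOT the Clay problem), width seat `ym-ust-19200-w3` gen 9.  `--supports stmt-QuantumFields-19200 --as helper`;
THEOREMS ONLY (0 `def`, 0 `sorry`); count-neutral; nothing here claims `hT4T`, `hMember`, `hSupUρ4`, the stub, the crux or the gap.

WHAT.  ★★ `rawP5base_of_lettersτ_cubeMember` — the companion of FILE A's ✓`rawP5_of_lettersτ_cubeMember` (same binders plus `1 ≤ k` and the base nearness letter `a` with `2a ≤ c⋆`, ✓p654692's `hfine`∕`ha2`):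
the raw BASE socket `hP5base` of ✓p654692 (level `0 → 1`, `G`-form, `α₄ := 8B₀′c⋆`) — `∃ (v, λ)`, `v` `G`-valued, `v = e^{iλ}` on the touched sides of levels `≤ 1`, (1.108), Landau (1.38)
at level `1` for `U′^{v⁻¹}`, (1.29) at level `1` for `1·v`.  The base datum `A₀ := (iη)⁻¹ log U′` (lit ✓`B8Thm4TruncationLocal.base_datum`, `|A₀| ≤ 2α₁η⁻¹ ≤ c⋆η⁻¹`) needs (1.66)
`|U′ − 1| ≤ a` on the sides touching `□₀` — READ OFF the fine row `hfine` on the collar `□̃` at depth `k` (every such side lies there: lit ✓`collar_cube` + ✓`ends_of_sideTouches`;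
at the member `hfine` is J3's tower row (d) at `m′ = k`, `Ū⁰ = U′`); `τ(A₀) = 0` by (H2) (`U′ ∈ G ≤ H`, `|U′ − 1| ≤ a ≤ ⅛` from `2a ≤ c⋆ ≤ 1∕8000`).  Then lit ✓`sockHFP₀_body_of_join_RD_traceFree` at the member and FILE A §1 at `m = 0`, `u₁ = 1`, `U₁ = U′`.
HONEST SCOPE.  By-name plumbing over landed lit theorems; the [4] letters (Thm 3.1 ∕ (3.25)), the b9 edge and the windows are DISPLAYED hypotheses; nothing of [4], Prop. 3∕5,
Theorem 4 or the stub is proved here.  Rung R3 (YM₃ on T³), NOT Clay; YM gap NOT proved.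

References: T. Bałaban, CMP **99** (1985) 75–102 [Balaban1985RegularSpaces] (Prop. 5 (1.106)–(1.109) p.94, p.89, Thm 4 p.88, (1.66) p.87, (1.29) p.81, (1.38) p.82, (1.131) p.99,
p.98, p.76); CMP **99** (1985) 389–434 [Balaban1985BackgroundPropagators] (Thm 3.1 p.397, (3.25) p.394, Thm 3.3 p.398); CMP **98** (1985) 17–51 [Balaban1985Averaging] ((43) p.24).
-/

set_option autoImplicit false

noncomputable section

open scoped BigOperators
open NormedSpace
open Complex (I)

namespace Summit.QuantumFields.YangMills.Theorems.HalvingHSiteRawP5BaseOfLeaf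

open Literature.MathematicalPhysics.QuantumFieldTheory.Balaban1983to89
open MatrixLog (mlog)
open B7Prop1Explicit (e expUnit U1 Site)
open B7Prop2Explicit (unitaryUnits unitaryUnits_le_U1 C0 c2' avgIter AvgClosed)
open B7Prop3Flat (c3)
open B7Prop10General (C6 C4G)
open B7Prop9Flat (C5')
open B7Prop1Local (InBox loK bondHiK)
open B7Eq78Linearization (conjR zdBlocking QprimeIter)
open B7Eq92Concrete (mgauge mgauge_apply Rc Rc_apply)
open B8Ineq130 (tlo thi)
open B8Ineq132 (covDerivFwd covDeriv InAk BondTouches)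
open B8Eq119TwistedAxial (Restr129 InAx bgT)
open B8Eq184Proof (gaugeExp cfgExp)
open B8Eq182Proof (gAd)
open B8Eq188Proof (frakF3)
open B8Lemma1NonAbelian (mulCfg)
open B8Eq140Level (SideTouches)
open B8Eq138LandauZd (IsLandau138W covDivB covLap QT isLandau138W_congr)
open B8Ineq125Concrete (C2p)
open B8Eq1117Concrete (XSpace)
open B8LeafModelZd3 (SockB9P3)
open B8Prop5ContractionKLevel (Bd2 Mc Kc)
open B8LambdaSpaceKLevel (wt)
open B8Prop5KLevelLetters (isLandau138W_gaugeFixed_of_multiplier)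
open B8Prop6OfThm4 (one_inAk)
open B8Eq131Cubes (tLo tHi collar_cube)
open B8Eq131CubesAdmissible (cubeFam cubeFam_false_of_le)
open B8CubeMemberZd (cubeLamS cubeLamB hΩ_cubeFam hbox_cubeLamB hclass_cubeLamB)
open B8SockHFPCubeMember (htw_cubeLamS h8lt_cubeLamS h8top_cubeLamS)
open B8SockHFPTraceFree (sockHFP_body_of_join_RD_traceFree sockHFP₀_body_of_join_RD_traceFree)
open B8SockHFPTorusTraceFree (apply_eq_zero_of_cfgExp_mem)
open B8Thm4TruncationLocal (base_datum)
open HalvingP1FlatCoreSupplierInduction (h34_of_inAk_univ hAx_of_inAx_one h135_cubeMember ends_of_sideTouches)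
open HalvingHSiteRawP5OfLeaf (hP5_step_mem_of_HFP)

variable {d : ℕ} {𝔸 : Type*} [CStarAlgebra 𝔸] [Nontrivial 𝔸]

/-! ## §1 The raw BASE socket `hP5base` (level `0 → 1`) at N05's cube member, flat background, from the letters at truncation `1` -/

set_option maxHeartbeats 400000 in
/-- ★★ **THE RAW PROPOSITION-5 BASE SOCKET `hP5base` OF ✓p654692 IN `G`-FORM, AT N05's CUBE MEMBER OF RECORD AND THE FLAT BACKGROUND, FROM THE [4] LETTERS AT TRUNCATION `1`** —
`∃ (v, λ)`, `v` `G`-valued, `v = e^{iλ}` on the touched sides of levels `≤ 1`, (1.108) at `α₄ = 8B₀′c⋆`, Landau (1.38) at level `1` for `U′^{v⁻¹}`, (1.29) at level `1` for `1·v` (p. 89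
«for k = 0 … u₁ = 1, U₁ = U′»).  The base datum `A₀ := (iη)⁻¹ log U′` (lit ✓`B8Thm4TruncationLocal.base_datum`; `|A₀| ≤ 2aη⁻¹ ≤ c⋆η⁻¹`) needs (1.66) `|U′ − 1| ≤ a` on the sides touching
`□₀` — READ OFF the tower row (d) at depth `m′ = k` (`Ū⁰ = U′`, lit ✓`avgIter_zero`) since every such side lies in the collar `□̃` (lit ✓`collar_cube` + ✓`ends_of_sideTouches`), with
`a := α₁`, `2α₁ ≤ c⋆` from `2 ≤ 5dLB₀`; `τ(A₀) = 0` by (H2) (`U′ ∈ G ≤ H`, `|U′ − 1| ≤ α₁ ≤ ⅛`).  Then lit ✓`sockHFP₀_body_of_join_RD_traceFree` at the member (k ≥ 1) and §1 at `m = 0`.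
[cite: Balaban1985RegularSpaces, Prop. 5 (1.106)–(1.109) p.94, p.89, (1.66) p.87, (1.131) p.99, p.98, p.76; Balaban1985BackgroundPropagators, Thm 3.1 p.397, (3.25) p.394] -/
theorem rawP5base_of_lettersτ_cubeMember (τ : 𝔸 →L[ℂ] ℂ) (hτ : ∀ x y : 𝔸, τ (x * y) = τ (y * x)) (hd2 : 2 ≤ d) {L : ℕ} (hL : 2 ≤ L) {η : ℝ} (hη : 0 < η)
    {k : ℕ} (hk : 1 ≤ k)
    -- the groups of the joint J-SU: `G` (averaging-closed, unitary; `1, U′, u₁ ∈ G`) `≤ H` ((H2), (H3)), and (G3) `e^{iλ} ∈ G` for Hermitian `τ`-free `λ`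
    -- (at `M₂(ℂ)`: `SU(2) ≤ SL(2, ℂ)` by lit ✓`B8SpecialLinearTrace`, (G3) by lit ✓`B8SpecialUnitaryTrace.gaugeExp_mem_specialUnitaryUnits`)
    {G H : Subgroup 𝔸ˣ} (hGrp2 : ∀ g ∈ H, ‖(g : 𝔸) - 1‖ ≤ 1 / 8 → τ (mlog (g : 𝔸)) = 0) (hGrp3 : ∀ S : 𝔸, τ S = 0 → expUnit S ∈ H)
    (hGA : AvgClosed d L G) (hGH : G ≤ H) (hGu : G ≤ unitaryUnits 𝔸)
    (hG3 : ∀ lam : Site d → 𝔸, (∀ x, IsSelfAdjoint (lam x)) → (∀ x, τ (lam x) = 0) → ∀ x, gaugeExp lam x ∈ G)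
    -- N05's cube member OF RECORD `Ω_j := □_j = cubeFam false L a M ρ k j` with its tower families (lit `B8CubeMemberZd`; defining equations, callers write `rfl`)
    (aC : Site d) (M : ℕ) {ρ : ℕ} (hρ : L ≤ ρ)
    {Ω : ℕ → Set (Site d)} (hΩdef : Ω = cubeFam false L aC M ρ k)
    {Λs : ℕ → ℕ → Set (Site d)} (hΛsdef : Λs = cubeLamS L aC M ρ k)
    {Λb : ℕ → ℕ → Set (Site d × Fin d)} (hΛbdef : Λb = cubeLamB L aC M ρ k)
    -- the constants and the pre-gauged field `U′` of J3 (`G`-valued), with J3's rows: (1.34)-𝔄 on `ℤᵈ`, axial at the flat background for every family (the base reads no (1.35))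
    {α₀ α₁ B₀ B₀' : ℝ} (hα₀ : 0 < α₀) (hα₁ : 0 < α₁) (hB₀ : 0 < B₀) (hB₀' : 0 < B₀')
    {U' : Site d → Fin d → 𝔸ˣ} (hU'G : ∀ x κ, U' x κ ∈ G)
    (hInAk : InAk L k η α₀ (fun _ => (Set.univ : Set (Site d))) U')
    (hAxJ : ∀ m', m' ≤ k → ∀ Λ : ℕ → Set (Site d), InAx L m' Λ (1 : Site d → Fin d → 𝔸ˣ) U')
    -- the b9 edge in Prop. 3's frame AT EVERY LEVEL `m ≤ k` (lit `SockB9P3`; [4] Thm 3.3 — N06), with its threshold `cB9`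
    {B₀β cB9 β : ℝ}
    (SB9all : ∀ m, m ≤ k → ∃ len : Site d → ℝ, SockB9P3 (𝔸 := 𝔸) L B₀ B₀β cB9 β len η m Ω Λs Λb)
    -- the base datum's nearness letter `a` (Theorem 4's (1.66) `|U′ − 1| ≤ a` on the collar `□̃` at depth `k`, `2a ≤ c⋆` — ✓p654692's `hfine`∕`ha2`; at the member `a := s`)
    {a : ℝ} (ha2 : 2 * a ≤ 5 * (d : ℝ) * L * B₀ * (α₀ + α₁))
    (hfine : ∀ (x : Site d) (ν : Fin d), tlo L (tLo aC ρ) k ≤ x → x + e ν ≤ thi L (tHi aC M ρ) k → ‖((U' x ν : 𝔸ˣ) : 𝔸) - 1‖ < a)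
    -- the [4] LETTERS AT EVERY TRUNCATION `n ≤ k` AT THE FLAT BACKGROUND, AS ONE ∃-PACKAGE PER `n`: lit `SockLettersRD`'s body at `(α₀, U₀ := 1, n)` ∧ lit `LettersTau`'s three
    -- fields (the shape of ✓p654110's `SLetτ`, there at `n := m + 1` only) — [4] Thm 3.1 ∕ (3.25) for Bałaban's operators `G Δ Q Q* A C H′` on the member's cube families (N05∕N06)
    {B₀'H B₂' BG BR : ℝ} (hB₀'H : 0 < B₀'H) (hB₂' : 0 ≤ B₂') (hBG : 0 ≤ BG) (hBR : 0 ≤ BR)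
    (SLetτ : ∀ n, 1 ≤ n → n ≤ k → ∃ (g Δ : (Site d → 𝔸) →ₗ[ℂ] (Site d → 𝔸)) (q : (Site d → 𝔸) →ₗ[ℂ] (ℕ → Site d → 𝔸))
        (qs : (ℕ → Site d → 𝔸) →ₗ[ℂ] (Site d → 𝔸)) (Aw c : (ℕ → Site d → 𝔸) →ₗ[ℂ] (ℕ → Site d → 𝔸)) (H' : XSpace d n 𝔸 →ₗ[ℂ] (Site d → 𝔸)),
      (∀ x, ∀ y ∈ Ω 0, (Δ (g x) + qs (Aw (q (g x)))) y = x y) ∧ (∀ f, q (g (g (qs (c (q f))))) = q f) ∧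
      (∀ (f : Site d → 𝔸), ∀ x ∈ Ω 0, Δ f x = covLap η (1 : Site d → Fin d → 𝔸ˣ) ((Ω 0).indicator f) x) ∧
      (∀ (μ : ℕ → Site d → 𝔸), ∀ x ∈ Ω 0, qs μ x = QT L n (Λs n) (1 : Site d → Fin d → 𝔸ˣ) μ x) ∧
      (∀ (f : Site d → 𝔸) (j : ℕ), j ≤ n → ∀ y ∈ Λs n j, q f j y = QprimeIter (zdBlocking d L) (bgT L (1 : Site d → Fin d → 𝔸ˣ)) j f y) ∧
      (∀ (X : XSpace d n 𝔸) (x : Site d), ‖H' X x‖ ≤ B₀'H * ‖X‖) ∧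
      (∀ j, j ≤ n → ∀ (X : XSpace d n 𝔸), ∀ p ∈ {b : Site d × Fin d | SideTouches (Ω j) b.1 b.2},
        wt L η j * ‖covDerivFwd η (1 : Site d → Fin d → 𝔸ˣ) p.2 (H' X) p.1‖ ≤ B₀'H * ‖X‖) ∧
      (∀ X : XSpace d n 𝔸, Bd2 L η n Ω (covLap η (1 : Site d → Fin d → 𝔸ˣ) (H' X)) (B₂' * ‖X‖)) ∧
      (∀ (X : XSpace d n 𝔸) (x : Site d), x ∉ Ω 0 → H' X x = 0) ∧
      (∀ X Y : XSpace d n 𝔸, (∀ p, Y p = -star (X p)) → ∀ x, H' Y x = -star (H' X x)) ∧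
      (∀ (Y : XSpace d n 𝔸) (j : ℕ) (hj : j ≤ n) (y : Site d), y ∈ Λs n j →
        QprimeIter (zdBlocking d L) (bgT L (1 : Site d → Fin d → 𝔸ˣ)) j (H' Y) y = Y (⟨j, Nat.lt_succ_of_le hj⟩, y)) ∧
      (∀ (f : Site d → 𝔸) (r : ℝ), 0 ≤ r → Bd2 L η n Ω f r →
        (∀ x, ‖g f x‖ ≤ BG * r) ∧ ∀ j, j ≤ n → ∀ p ∈ {b : Site d × Fin d | SideTouches (Ω j) b.1 b.2},
          wt L η j * ‖covDerivFwd η (1 : Site d → Fin d → 𝔸ˣ) p.2 (g f) p.1‖ ≤ BG * r) ∧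
      (∀ (f : Site d → 𝔸) (x : Site d), x ∉ Ω 0 → g f x = 0) ∧
      (∀ f : Site d → 𝔸, (∀ j, j ≤ n → ∀ x ∈ Ω j, IsSelfAdjoint (f x)) → ∀ x, IsSelfAdjoint (g f x)) ∧
      (∀ (f : Site d → 𝔸) (r : ℝ), 0 ≤ r → Bd2 L η n Ω f r → Bd2 L η n Ω (f - g (qs (c (q (g f))))) (BR * r)) ∧
      (∀ f : Site d → 𝔸, (∀ j, j ≤ n → ∀ x ∈ Ω j, IsSelfAdjoint (f x)) → ∀ j, j ≤ n → ∀ x ∈ Ω j, IsSelfAdjoint ((f - g (qs (c (q (g f))))) x)) ∧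
      (∀ X : XSpace d n 𝔸, (∀ p, τ (X p) = 0) → ∀ x, τ (H' X x) = 0) ∧
      (∀ f : Site d → 𝔸, (∀ j, j ≤ n → ∀ x ∈ Ω j, τ (f x) = 0) → ∀ x, τ (g f x) = 0) ∧
      (∀ f : Site d → 𝔸, (∀ j, j ≤ n → ∀ x ∈ Ω j, τ (f x) = 0) → ∀ j, j ≤ n → ∀ x ∈ Ω j, τ ((f - g (qs (c (q (g f))))) x) = 0))
    -- the JOIN's scalar windows at this `(α₀, α₁)` AS ONE CONJUNCTION — letter for letter the conclusion of lit ✓`B8SockHFPWindows.hfpWindows_of_guard` (= the `hwin` of lit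
    -- ✓`B8SockHFPTorusTraceFree.sockHFPτ_family_of_lettersAt`): Prop. 3's four, the b9 thresholds, the Sect. D∕E JOIN's, at `c⋆ = 5dLB₀(α₀ + α₁)`, `α₄ = 8B₀′c⋆`, `cB = cA = L·c⋆`, `cDA = 2dL²·c⋆`
    (hwin : ∀ cs α₄ cB cDA hE hE₂ lE lE₂ : ℝ, cs = 5 * (d : ℝ) * L * B₀ * (α₀ + α₁) → α₄ = 8 * B₀' * (5 * (d : ℝ) * L * B₀) * (α₀ + α₁) →
      cB = L * cs → cDA = 2 * (d : ℝ) * (L : ℝ) ^ 2 * cs →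
      hE = B₀'H * (C2p d * (40 * d * cB + α₄) * α₄) → hE₂ = B₂' * (C2p d * (40 * d * cB + α₄) * α₄) →
      lE = B₀'H * (4 * C2p d * (40 * d * cB + 2 * α₄)) → lE₂ = B₂' * (4 * C2p d * (40 * d * cB + 2 * α₄)) →
      36 * d * B₀ * cs ≤ 1 / 2 ∧
      8 * (131072 * ((d : ℝ) + 1) ^ 2) * Real.exp (4 * (800 * ((d : ℝ) + 1) ^ 2 * ((d : ℝ) + 4)) * α₀) ≤ 16 * (131072 * ((d : ℝ) + 1) ^ 2) ∧
      2 * cs ^ 2 + 20 * d * α₀ * cs + 2 * (16 * (131072 * ((d : ℝ) + 1) ^ 2)) * cs ^ 2 ≤ α₀ + α₁ ∧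
      (d : ℝ) * L * α₁ ≤ 1 / 8 ∧
      α₀ ≤ cB9 ∧ cs ≤ cB9 ∧
      C0 d * α₀ ≤ 1 / 3 ∧ 4 * α₀ ≤ c2' d L ∧
      Real.exp (4 * (800 * ((d : ℝ) + 1) ^ 2 * ((d : ℝ) + 4)) * α₀) * (1 + 8 * (131072 * ((d : ℝ) + 1) ^ 2) * cB) ≤ 2 ∧
      2 * cB ≤ c3 d L ∧ 2048 * (d : ℝ) * cB ≤ 1 ∧ 40 * d * cB ≤ 1 / 200 ∧
      200 * C6 d * (2 * α₄) ≤ 1 ∧ 12000 * ((d : ℝ) + 1) * L * (2 * α₄) ≤ 1 ∧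
      C4G d L * (α₀ + 40 * d * cB + 4 * (2 * α₄)) ≤ 1 ∧
      1024 * ((d : ℝ) + 1) * ((d : ℝ) + 4) * L ^ 2 * α₀ ≤ 1 ∧ 32 * ((d : ℝ) + 1) ^ 2 * C6 d * L ^ 2 * α₀ ≤ 1 ∧
      16 * d * C5' d * C6 d * (L : ℝ) ^ 2 * α₀ ≤ 1 ∧ 8 * d * C6 d * L * α₀ ≤ 1 ∧
      40 * d * cB + α₄ ≤ 1 / (4 * B₀'H * (2 * C2p d)) ∧ 2 * C6 d * (40 * d * cB + 4 * α₄) ≤ 1 / 8 ∧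
      cB ≤ 1 / 13 ∧ α₄ / 4 + hE ≤ 1 / 24 ∧ α₄ / 4 + hE ≤ 1 / 140 ∧ 10 * (α₄ / 4 + hE) * BR ≤ 1 / 2 ∧
      BG * Mc d BR (α₄ / 4 + hE) cB hE₂ cDA ≤ α₄ / 4 ∧
      BG * Kc d BR (α₄ / 4 + hE) cB hE₂ cDA lE₂ (1 + lE) (1 + lE) ≤ 1 / 2) :
    ∃ (v : Site d → 𝔸ˣ) (lam : Site d → 𝔸), (∀ x, v x ∈ G) ∧
      (∀ j, j ≤ 1 → ∀ b ∈ {b : Site d × Fin d | SideTouches (Ω j) b.1 b.2}, (v b.1 : 𝔸) = ((gaugeExp lam b.1 : 𝔸ˣ) : 𝔸) ∧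
        (v (b.1 + e b.2) : 𝔸) = ((gaugeExp lam (b.1 + e b.2) : 𝔸ˣ) : 𝔸)) ∧
      (∀ j, j ≤ 1 → ∀ b ∈ {b : Site d × Fin d | SideTouches (Ω j) b.1 b.2},
        ‖lam b.1‖ ≤ 8 * B₀' * (5 * (d : ℝ) * L * B₀) * (α₀ + α₁) ∧
          ((L : ℝ) ^ j * η) * ‖covDerivFwd η (1 : Site d → Fin d → 𝔸ˣ) b.2 lam b.1‖ ≤ 8 * B₀' * (5 * (d : ℝ) * L * B₀) * (α₀ + α₁)) ∧
      IsLandau138W L 1 η (Ω 0) (Λs 1) (1 : Site d → Fin d → 𝔸ˣ) (mgauge (1 : Site d → Fin d → 𝔸ˣ) v⁻¹ U') ∧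
      Restr129 L 1 (Λs 1) (1 : Site d → Fin d → 𝔸ˣ) ((1 : Site d → 𝔸ˣ) * v) := by
  subst hΩdef hΛsdef hΛbdef
  have hL1 : 1 ≤ L := le_trans (by norm_num) hL
  have hLr : (1 : ℝ) ≤ L := by exact_mod_cast hL1
  have hρ1 : 1 ≤ ρ := hL1.trans hρ
  -- the windows at this `(α₀, α₁)`
  obtain ⟨hside, hC₂, h61, hsmall₁, hα₀9, hcs9, hα3, hα4, hsmall, hc₃, hsc, hα₃', hs₁, hs₂, hs₃, hs₄, hs₅, hs₆, hs₇, hsm, hprod8, hcA', ha₁',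
    hb₁', hθ, h103, h106⟩ := hwin _ _ _ _ _ _ _ _ rfl rfl rfl rfl rfl rfl rfl rfl
  have hsum : 0 < α₀ + α₁ := add_pos hα₀ hα₁
  have hcs0 : 0 ≤ 5 * (d : ℝ) * L * B₀ * (α₀ + α₁) := by positivity
  -- `c⋆ ≤ 1∕8000` (hence `16c⋆ ≤ 1`, `c⋆ ≤ 1∕12`), `α₄ ≤ 1∕84`, `2α₁ ≤ c⋆`, `α₁ ≤ ¼` from the windows and `2 ≤ 5dLB₀`
  have h16 : 16 * (5 * (d : ℝ) * L * B₀ * (α₀ + α₁)) ≤ 1 := by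
    have hd0 : (1 : ℝ) ≤ d := by exact_mod_cast (show 1 ≤ d by omega)
    have hcsB : 5 * (d : ℝ) * L * B₀ * (α₀ + α₁) ≤ L * (5 * (d : ℝ) * L * B₀ * (α₀ + α₁)) := le_mul_of_one_le_left hcs0 hLr
    have hcBsmall : (d : ℝ) * (L * (5 * (d : ℝ) * L * B₀ * (α₀ + α₁))) ≤ 1 / 8000 := by linarith only [hα₃']
    have h1 : 5 * (d : ℝ) * L * B₀ * (α₀ + α₁) ≤ 1 / 8000 :=
      ((le_mul_of_one_le_left hcs0 hd0).trans (mul_le_mul_of_nonneg_left hcsB (by positivity))).trans hcBsmall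
    linarith only [h1]
  have hcs12 : 5 * (d : ℝ) * L * B₀ * (α₀ + α₁) ≤ 1 / 12 := by linarith only [h16, hcs0]
  have hα84 : 8 * B₀' * (5 * (d : ℝ) * L * B₀) * (α₀ + α₁) ≤ 1 / 84 := by
    have hC6 : (2 : ℝ) ≤ C6 d := B7ConclGaugeLin.two_le_C6'
    have hα₄0 : 0 ≤ 8 * B₀' * (5 * (d : ℝ) * L * B₀) * (α₀ + α₁) := by positivity
    have h := mul_le_mul_of_nonneg_right hC6 (by positivity : (0 : ℝ) ≤ 200 * (2 * (8 * B₀' * (5 * (d : ℝ) * L * B₀) * (α₀ + α₁))))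
    nlinarith only [hs₁, h, hα₄0]
  have ha4 : a ≤ 1 / 4 := by linarith only [ha2, hcs12]
  have ha8 : a ≤ 1 / 8 := by linarith only [ha2, h16, hcs0]
  -- the member geometry (lit `B8CubeMemberZd` ∕ `B8SockHFPCubeMember`, BY NAME)
  have hΩ := hΩ_cubeFam (d := d) hL1 aC M hρ k
  have htower := htw_cubeLamS (d := d) hL1 aC M ρ k 1 hk
  -- the pre-gauged field's rows at the flat background
  have h33 : InAk L k η α₀ (cubeFam false L aC M ρ k) (1 : Site d → Fin d → 𝔸ˣ) := one_inAk hL1 k hη hα₀ _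
  have h34 := h34_of_inAk_univ hInAk (cubeFam false L aC M ρ k)
  have hAx := hAx_of_inAx_one hAxJ (cubeLamS L aC M ρ k)
  -- group data
  have h1G : ∀ (x : Site d) (κ : Fin d), (1 : Site d → Fin d → 𝔸ˣ) x κ ∈ G := fun _ _ => G.one_mem
  have hU' : ∀ x κ, U' x κ ∈ unitaryUnits 𝔸 := fun x κ => hGu (hU'G x κ)
  -- (1.66) on the sides touching `□₀`, read off the fine row on the collar `□̃` at depth `k`
  have h66 : ∀ b ∈ {b : Site d × Fin d | SideTouches (cubeFam false L aC M ρ k 0) b.1 b.2}, ‖((U' b.1 b.2 : 𝔸ˣ) : 𝔸) - 1‖ ≤ a := by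
    intro b hb
    have hb' : SideTouches (cubeFam false L aC M ρ k 0) b.1 b.2 := hb
    rw [cubeFam_false_of_le L aC M ρ (Nat.zero_le k)] at hb'
    obtain ⟨h1, h2⟩ := ends_of_sideTouches (collar_cube hL hρ1 (Nat.zero_le k)) hb'
    exact (hfine b.1 b.2 h1 h2).le
  -- the base datum `A₀ := (iη)⁻¹ log U′` (lit ✓`base_datum`): chart, Hermitian, `|A₀| ≤ 2aη⁻¹ ≤ c⋆η⁻¹`; `τ`-free by (H2)
  have hdat : ∀ j, j ≤ 0 → ∀ b ∈ {b : Site d × Fin d | SideTouches (cubeFam false L aC M ρ k j) b.1 b.2},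
      U' b.1 b.2 = cfgExp η (fun y μ => η⁻¹ • ((I⁻¹ : ℂ) • mlog ((U' y μ : 𝔸ˣ) : 𝔸))) b.1 b.2 ∧
        IsSelfAdjoint ((fun y μ => η⁻¹ • ((I⁻¹ : ℂ) • mlog ((U' y μ : 𝔸ˣ) : 𝔸))) b.1 b.2) ∧
        ‖(fun y μ => η⁻¹ • ((I⁻¹ : ℂ) • mlog ((U' y μ : 𝔸ˣ) : 𝔸))) b.1 b.2‖ ≤ (5 * (d : ℝ) * L * B₀ * (α₀ + α₁)) * ((L : ℝ) ^ j * η)⁻¹ := by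
    intro j hj b hb
    obtain rfl : j = 0 := Nat.le_zero.mp hj
    obtain ⟨-, hexp, hsa, hn⟩ := base_datum hη (1 : Site d → Fin d → 𝔸ˣ) U' hU' ha4 b.1 b.2 (h66 b hb)
    refine ⟨hexp, hsa, hn.trans ?_⟩
    rw [pow_zero, one_mul]
    exact mul_le_mul_of_nonneg_right ha2 (inv_nonneg.mpr hη.le)
  have hAτ : ∀ j, j ≤ 0 → ∀ b ∈ {b : Site d × Fin d | SideTouches (cubeFam false L aC M ρ k j) b.1 b.2},
      τ ((fun y μ => η⁻¹ • ((I⁻¹ : ℂ) • mlog ((U' y μ : 𝔸ˣ) : 𝔸))) b.1 b.2) = 0 := by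
    intro j hj b hb
    obtain rfl : j = 0 := Nat.le_zero.mp hj
    have h0 : τ (mlog ((U' b.1 b.2 : 𝔸ˣ) : 𝔸)) = 0 := hGrp2 _ (hGH (hU'G b.1 b.2)) ((h66 b hb).trans ha8)
    show τ (η⁻¹ • ((I⁻¹ : ℂ) • mlog ((U' b.1 b.2 : 𝔸ˣ) : 𝔸))) = 0
    rw [RCLike.real_smul_eq_coe_smul (K := ℂ), map_smul, map_smul, h0, smul_zero, smul_zero]
  -- the letters at truncation `1` with their `τ`-laws
  obtain ⟨g, Δ, q, qs, Aw, c, H', g_rightΩ, c_range, hΔ, hqs, hq, hH0, hH1, hH2, hHsupp, hHequiv, hQH, hG, hGsupp, hGreal, hRbd, hRreal, hHτ, hGτ, hRτ⟩ :=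
    SLetτ 1 le_rfl hk
  -- THE `τ`-FREE BASE JOIN (lit, BY NAME) at the member
  obtain ⟨lam, hlsa, -, hlτ, h108, hmul, h129'⟩ := sockHFP₀_body_of_join_RD_traceFree τ hτ hd2 hL hη hk hGrp2 hGrp3 hGA hGH hGu hΩ htower hα₀ hα₁ hB₀ hB₀'
    rfl rfl h1G h33 h34 hAx hdat hAτ g Δ q qs Aw c g_rightΩ c_range hΔ hqs hq H' hB₀'H hB₂' hBG hBR hH0 hH1 hH2 hHsupp hHequiv hQH hG hGsupp hGreal hRbd
    hRreal hHτ hGτ hRτ le_rfl le_rfl le_rfl hα3 hα4 hsmall hc₃ hsc hα₃' hs₁ hs₂ hs₃ hs₄ hs₅ hs₆ hs₇ hsm hprod8 rfl rfl rfl rfl hcA' ha₁' hb₁' hθ h103 h106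
  -- the `G`-form step adapter (§1) at `m = 0`, `u₁ = 1`, `U₁ = U′`, with (G3)
  have h1u : ∀ (x : Site d) (κ : Fin d), (1 : Site d → Fin d → 𝔸ˣ) x κ ∈ unitaryUnits 𝔸 := fun _ _ => (unitaryUnits 𝔸).one_mem
  exact hP5_step_mem_of_HFP hd2 hη L 0 G h1u hα84 hcs12 _ _ 1 U' _ hdat lam (hG3 lam hlsa hlτ) h108 hmul h129'

end Summit.QuantumFields.YangMills.Theorems.HalvingHSiteRawP5BaseOfLeaf

end
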